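import Summits.BirchSwinnertonDyer.BirchSwinnertonDyer.Theorems.ManinLocalTwoThreeParabolicity
import Summits.BirchSwinnertonDyer.BirchSwinnertonDyer.Theorems.ManinLocalTwoThreeCocycleBaseChange
import HarnessLib

/-!
# E-es-25 `RelativeIharaShiftVanishingBar p t n` HOLDS — the relative Ihara lemma at a prime power dividing the level

Summit `BirchSwinnertonDyer`, route `ManinLocalTwoThree` (cell bsd-f2-manin), cruxes C2 `ManinOddAtFour`
(stmt-BirchSwinnertonDyer-22967, deciding) / C3 `ManinPrimeToThreeAtNine` (stmt-BirchSwinnertonDyer-22968).  The cell's leaf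
`Summit.BirchSwinnertonDyer.Rank1Residual.ManinAdditive.RelativeIharaShiftVanishingBar p t n` (E-es-25, planner bsd-f2-manin-es,
typed p596841, `@[conjecture]`, nothing asserted there) — «a generalised Hecke eigen-homomorphism `u : Γ₀(L) → K` with
`π_{tⁿ}^* u = π_1^* u` and non-Eisenstein eigenvalues is `0`», for ALL primes `p`, `t` (`t = p`, `t ∣ L` allowed) and `n ≥ 1`
— is the hypothesis `hRI` of both generation stubs (`stub_shiftClass_generation` on C3 via p3's
`shiftClassGenerationThree_of_relativeIharaBar`, `stub_multiShiftClass_generation` on C2 via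
`multiShiftClassGenerationTwo_of_relativeIharaBar`).  The cell proved it along the Ihara-free route of MEMO-es §23
(symbol LIFT + LEMMA G + congruence-subgroup property over `ℤ[1/t]` + HECKE-DIAMOND, with E-es-29a/E-es-30 for the symbol
layer): p3's `relativeIharaShiftVanishingBar_of_parabolic_algClosed`
(`Theorems/ManinLocalTwoThreeCocycleBaseChange.lean`) reduces the leaf to ONE input — PARABOLICITY of non-Eisenstein
generalised eigenclasses over algebraically closed fields — which is `parabolic_of_isHeckeGenEigenvector`
(`Theorems/ManinLocalTwoThreeParabolicity.lean`, this seat).  This file composes the two: **`relativeIharaShiftVanishingBar_holds`**.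

Authorship of the inputs (all `Summits/…/Theorems/ManinLocalTwoThree*.lean`, cell bsd-f2-manin 2026-08-28): LEMMA G / shift
closure (p1), cocycle–symbol dictionary, (BND), LIFT, diamond bottom and end, base change (p3), E-es-29a, E-es-30, N4
parabolicity (p2), typer vocabulary `Gamma0CocycleDegeneracyMaps` (-ty), plan MEMO-es §21–§25 (-es).  BSD is not proved by
this; Manin's conjecture is not proved by this: the leaf feeds the generation stubs only, and the C2/C3 skeletons carry further
residual stubs (Ra/Rb at 2, the reducible residual at 3, the Kato facts).

References: K. Ribet, *Congruence relations between modular forms*, Proc. ICM 1983 (1984), Thm. 4.1 (classical `t ∤ L`, `n = 1`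
shape) [cite: Ribet1984ICM, Thm. 4.1 (shape only)]; H. Darmon, F. Diamond, R. Taylor, *Fermat's Last Theorem* (1995), Lemma 4.28,
Remark 4.29 (Khare's modular-symbol method); cell memo HOME/MEMO-es.md §21–§23.
-/

set_option autoImplicit false
set_option linter.dupNamespace false

namespace Summit.BirchSwinnertonDyer.BirchSwinnertonDyer.Theorems.ManinLocalTwoThree

/-- **E-es-25 holds: `RelativeIharaShiftVanishingBar p t n` for all `p, t, n`** (the guards `p.Prime → t.Prime → 1 ≤ n →`
are part of the leaf).  Composition of p3's reduction to parabolicity over algebraically closed fields with this seat's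
`parabolic_of_isHeckeGenEigenvector`. [cite: Ribet1984ICM, Thm. 4.1 (shape only)] -/
theorem relativeIharaShiftVanishingBar_holds (p t n : ℕ) :
    Summit.BirchSwinnertonDyer.Rank1Residual.ManinAdditive.RelativeIharaShiftVanishingBar p t n :=
  relativeIharaShiftVanishingBar_of_parabolic_algClosed fun _ _ _ L _ S hS lam u hgen hne γ c hγ ↦
    parabolic_of_isHeckeGenEigenvector L S hS lam u hgen hne γ c hγ

end Summit.BirchSwinnertonDyer.BirchSwinnertonDyer.Theorems.ManinLocalTwoThree
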